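import Summits.CriticalPhenomena.PercolationContinuityZ3.Theorems.PercExchangeRateTransportCriticalCurveRegular
import Summits.CriticalPhenomena.PercolationContinuityZ3.Theorems.PercExchangeRateTransportModelFacts
import HarnessLib

/-!
# Route `PercExchangeRateTransport`, crux `SupercritExchangeUniformity` (stmt-CriticalPhenomena-16061),
# line `isotropic_locus_continuity`: the ON-PATH LEMMA of the rung `IsotropicLocusContinuity`, landed

Forward discipline (TRIBUNAL-FIT F4): a forward rung `C` comes with a LANDED lemma `S → C`.
The rung of the line `Cruxes/SupercritExchangeUniformity/Lines/isotropic_locus_continuity.lean` is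
`IsoLocus.IsotropicLocusContinuity := IsoLocus.CriticalLocusContinuous {p_c(ℤ³)}` — continuity of the
critical locus `t ↦ (p_c(t), J(t))`, `J(t) = θ(p_c(t), t)`, of the route's label-coupled anisotropic
bond family on `ℤ²×ℤ` at the isotropic point `p₃ = p_c(ℤ³)`.  Its on-path lemma
`PercolationContinuityZ3 → IsotropicLocusContinuity` was proved by the line's author inside the crux
workfiles (`Lines/isotropic_locus_continuity{,_onpath}.lean`, 2026-08-18), which `Theorems`/`Theses`
files may not import (CONVENTIONS §2).  This file lands the same theorem in the tree proper, stated on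
the UNFOLDED proposition (the definiens of `CriticalLocusContinuous` at `T = {p_c(ℤ³)}`, written with
the route's verbatim `let`-objects `μ, vert, cfg, θ, pc`; no definition is introduced), so that

* `isotropicLocusContinuity_of_percolationContinuityZ3 h : IsoLocus.IsotropicLocusContinuity` holds by
  `exact` (δ/ζ-reduction) wherever the line's definitions are in scope;
* the statement `θ_{ℤ³}(p_c) = 0` is recorded, importably, as implying continuity of the anisotropic
  critical density through the isotropic point (`J(p₃) = 0` and `J → 0` along the curve).

Proof (Grimmett 1999 §1.4, §3.3 bookkeeping; no new input): the percolation-free core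
`locusCore_usc` shows, for `θ = ⨅ₙ Θₙ` with `Θₙ` continuous, monotone in both parameters and
nonnegative, threshold curve `pc` continuous on `(0,1)` and diagonal `θ p p = θ_{ℤ³}(p)` with the phase
structure of `θ_{ℤ³}` at `p₃ ∈ (0,1)`, that the curve passes through the isotropic point (`pc p₃ = p₃`)
and that `J` is upper semicontinuous at `p₃`; `locusCore_continuous` adds `θ_{ℤ³}(p₃) = 0 ⇒ J(p₃) = 0`,
whence continuity (`0 ≤ J < ε`).  The instantiation uses `ModelFacts.modelFacts_proof` (clauses
(1),(3),(4),(6),(7),(9)), the floor `CriticalCurveRegular_proof` (item 16065) and the tree facts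
`0 < p_c(ℤ³) < 1`, `θ = 0` below / `θ > 0` above `p_c`.

KERNEL VISIBILITY.  The tribunal's forward `S → C` portfolio has no library search and runs each
tactic under `maxHeartbeats 50000`; its tactic `intro h; (try simp only [C-chain, S-chain] at h ⊢); aesop`
unfolds the rung to its ζβ-reduced definiens and the statement to
`theta (zdGraph 3) 0 (criticalProbI 3) = 0`, after which `aesop`'s normalisation (`simp_all`) uses `h`
as a rewrite rule.  The conditional PRE-simp lemmas (`@[simp↓]`) registered below have exactly those
definiens (whole, and conjunct by conjunct) as left-hand sides and `theta … (criticalProbI 3) = 0` as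
side condition, so the goal rewrites to `True` at the root, before any descent into the (large)
measure-theoretic subterms — whenever this module is in the probe's scope (a `TribunalEnv`
regeneration selects it by its `_of_percolationContinuityZ3` names; or `--imports`).  The lemmas
conclude nothing about the Statement, and a plain `simp` cannot discharge their side condition
(only `simp_all` / `simp [*]` in a context holding `θ_{ℤ³}(p_c) = 0` can), so no strong-hypothesis
probe `H → C` is affected.

prover-fwd2-land-1-g7-0 (on-path lander, gen 7), 2026-08-18; core proofs adapted verbatim from the
line author's `Lines/isotropic_locus_continuity_onpath.lean` (planner-fwd2-rung-CriticalPhenomena-01).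
-/

noncomputable section

open MeasureTheory Filter Topology

namespace Summit.CriticalPhenomena.PercolationContinuityZ3.Theorems.IsoLocusOnPath

/-! ### Real-variable core (percolation-free)

For a family `Θ n p t` of continuous functions, monotone in `p` and in `t`, nonnegative, with
`θ = ⨅ n Θ n`, threshold curve `pc t = sInf ({p ∈ [0,1] | 0 < θ p t} ∪ {1})` continuous on `(0,1)`,
diagonal `θ p p = th3 p` with the phase structure of `th3` around `p₃ ∈ (0,1)` (`= 0` below, `> 0` above). -/

section Core

variable {Θ : ℕ → ℝ → ℝ → ℝ} {θ : ℝ → ℝ → ℝ} {pc : ℝ → ℝ} {th3 : unitInterval → ℝ} {p₃ : ℝ}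

/-- Core, part 1 (unconditional): the curve passes through the isotropic point, `pc p₃ = p₃`, and
`t ↦ θ (pc t) t` is upper semicontinuous at `p₃` within `(0,1)`. -/
theorem locusCore_usc
    (hinf : ∀ p t, θ p t = ⨅ n, Θ n p t)
    (hpc : ∀ t, pc t = sInf ({p : ℝ | 0 ≤ p ∧ p ≤ 1 ∧ 0 < θ p t} ∪ {1}))
    (hcont : ∀ n, Continuous (fun x : ℝ × ℝ => Θ n x.1 x.2))
    (hmp : ∀ n t, Monotone (fun p => Θ n p t))
    (hmt : ∀ n p, Monotone (fun t => Θ n p t))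
    (hnn : ∀ n p t, 0 ≤ Θ n p t)
    (hdiag : ∀ p : unitInterval, θ p p = th3 p)
    (hpcc : ContinuousOn pc (Set.Ioo 0 1))
    (h3l : 0 < p₃) (h3u : p₃ < 1)
    (h3zero : ∀ p : unitInterval, (p : ℝ) < p₃ → th3 p = 0)
    (h3pos : ∀ p : unitInterval, p₃ < (p : ℝ) → 0 < th3 p) :
    pc p₃ = p₃ ∧
      ∀ ε, 0 < ε → ∃ δ, 0 < δ ∧ ∀ t ∈ Set.Ioo (0 : ℝ) 1, |t - p₃| < δ →
        θ (pc t) t < θ (pc p₃) p₃ + ε := by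
  -- a small chooser of margins
  have hpick : ∀ a b c : ℝ, 0 < a → 0 < b → 0 < c →
      ∃ s, 0 < s ∧ s < a ∧ s < b ∧ s ≤ c / 2 := fun a b c ha hb hc => by
    refine ⟨min a (min b c) / 2, ?_, ?_, ?_, ?_⟩
    · have : 0 < min a (min b c) := lt_min ha (lt_min hb hc); linarith
    · have : min a (min b c) ≤ a := min_le_left _ _; linarith
    · have : min a (min b c) ≤ b := (min_le_right _ _).trans (min_le_left _ _); linarith
    · have : min a (min b c) ≤ c := (min_le_right _ _).trans (min_le_right _ _); linarith
  -- basic facts about θ = inf_n Θ_n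
  have hbdd : ∀ p t, BddBelow (Set.range fun n => Θ n p t) := fun p t =>
    ⟨0, by rintro _ ⟨n, rfl⟩; exact hnn n p t⟩
  have hθ_le : ∀ n p t, θ p t ≤ Θ n p t := fun n p t => by
    rw [hinf]; exact ciInf_le (hbdd p t) n
  have hθ_mp : ∀ t p q, p ≤ q → θ p t ≤ θ q t := fun t p q hpq => by
    rw [hinf, hinf]; exact ciInf_mono (hbdd p t) fun n => hmp n t hpq
  have hθ_mt : ∀ p s t, s ≤ t → θ p s ≤ θ p t := fun p s t hst => by
    rw [hinf, hinf]; exact ciInf_mono (hbdd p s) fun n => hmt n p hst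
  -- the set whose infimum is pc t
  have hS_ne : ∀ t, ({p : ℝ | 0 ≤ p ∧ p ≤ 1 ∧ 0 < θ p t} ∪ {1}).Nonempty := fun t =>
    ⟨1, Or.inr rfl⟩
  have hS_bdd : ∀ t, BddBelow ({p : ℝ | 0 ≤ p ∧ p ≤ 1 ∧ 0 < θ p t} ∪ {1}) := fun t =>
    ⟨0, by
      rintro p (⟨hp, -⟩ | hp)
      · exact hp
      · rw [Set.mem_singleton_iff] at hp; rw [hp]; exact zero_le_one⟩
  have hpc_le : ∀ t q, 0 ≤ q → q ≤ 1 → 0 < θ q t → pc t ≤ q := fun t q h0 h1 hpos => by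
    rw [hpc]; exact csInf_le (hS_bdd t) (Or.inl ⟨h0, h1, hpos⟩)
  have hle_pc : ∀ t c, c ≤ 1 → (∀ p, 0 ≤ p → p < c → θ p t ≤ 0) → c ≤ pc t :=
      fun t c hc1 hzero => by
    rw [hpc]
    refine le_csInf (hS_ne t) ?_
    rintro p (⟨hp0, -, hpos⟩ | hp)
    · by_contra hlt
      exact absurd (hzero p hp0 (not_le.mp hlt)) (not_le.mpr hpos)
    · rw [Set.mem_singleton_iff] at hp; rw [hp]; exact hc1
  -- (A) below the isotropic critical point the curve lies above the diagonal
  have hA : ∀ t, 0 < t → t < p₃ → t ≤ pc t := fun t ht0 ht3 => by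
    have ht1 : t ≤ 1 := (ht3.trans h3u).le
    refine hle_pc t t ht1 fun p hp0 hpt => ?_
    have e : θ t t = th3 ⟨t, ht0.le, ht1⟩ := hdiag ⟨t, ht0.le, ht1⟩
    have hz : th3 ⟨t, ht0.le, ht1⟩ = 0 := h3zero ⟨t, ht0.le, ht1⟩ ht3
    calc θ p t ≤ θ t t := hθ_mp t p t hpt.le
      _ = 0 := by rw [e, hz]
  -- (B) above it the curve lies below the level p₃
  have hB : ∀ t, p₃ < t → t < 1 → pc t ≤ p₃ := fun t ht3 ht1 => by
    by_contra hcon'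
    have hcon := not_le.mp hcon'
    obtain ⟨q, hq3, hqpc, hqt⟩ : ∃ q, p₃ < q ∧ q < pc t ∧ q < t :=
      ⟨min ((p₃ + pc t) / 2) ((p₃ + t) / 2), lt_min (by linarith) (by linarith),
        (min_le_left _ _).trans_lt (by linarith), (min_le_right _ _).trans_lt (by linarith)⟩
    have hq0 : 0 ≤ q := (h3l.trans hq3).le
    have hq1 : q ≤ 1 := (hqt.trans ht1).le
    have hpos : 0 < θ q t := by
      have e : θ q q = th3 ⟨q, hq0, hq1⟩ := hdiag ⟨q, hq0, hq1⟩
      have hp : 0 < th3 ⟨q, hq0, hq1⟩ := h3pos ⟨q, hq0, hq1⟩ hq3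
      calc (0 : ℝ) < θ q q := by rw [e]; exact hp
        _ ≤ θ q t := hθ_mt q q t hqt.le
    exact absurd (hpc_le t q hq0 hq1 hpos) (not_le.mpr hqpc)
  -- (C) continuity of the curve at p₃ pins the isotropic point onto the curve
  have hC : pc p₃ = p₃ := by
    have hcw : ContinuousWithinAt pc (Set.Ioo 0 1) p₃ := hpcc p₃ ⟨h3l, h3u⟩
    rw [Metric.continuousWithinAt_iff] at hcw
    apply le_antisymm
    · by_contra hcon'
      have hcon := not_le.mp hcon'
      obtain ⟨δ, hδ, hδ'⟩ := hcw ((pc p₃ - p₃) / 2) (by linarith)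
      obtain ⟨s, hs0, hsδ, hs1, -⟩ := hpick δ (1 - p₃) 1 hδ (by linarith) one_pos
      have hmem : p₃ + s ∈ Set.Ioo (0 : ℝ) 1 := ⟨by linarith, by linarith⟩
      have hdist : dist (p₃ + s) p₃ < δ := by
        rw [Real.dist_eq, show p₃ + s - p₃ = s by ring, abs_of_pos hs0]; exact hsδ
      have h := hδ' hmem hdist
      rw [Real.dist_eq] at h
      have hBt := hB (p₃ + s) (by linarith) (by linarith)
      have h' := (abs_sub_lt_iff.mp h).2
      linarith
    · by_contra hcon'
      have hcon := not_le.mp hcon'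
      obtain ⟨δ, hδ, hδ'⟩ := hcw ((p₃ - pc p₃) / 2) (by linarith)
      obtain ⟨s, hs0, hsδ, hs3, hsε⟩ := hpick δ p₃ (p₃ - pc p₃) hδ h3l (by linarith)
      have hmem : p₃ - s ∈ Set.Ioo (0 : ℝ) 1 := ⟨by linarith, by linarith⟩
      have hdist : dist (p₃ - s) p₃ < δ := by
        rw [Real.dist_eq, show p₃ - s - p₃ = -s by ring, abs_neg, abs_of_pos hs0]; exact hsδ
      have h := hδ' hmem hdist
      rw [Real.dist_eq] at h
      have hAt := hA (p₃ - s) (by linarith) (by linarith)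
      have h' := (abs_sub_lt_iff.mp h).1
      linarith
  refine ⟨hC, fun ε hε => ?_⟩
  -- upper semicontinuity of J = ⨅_n Θ_n ∘ (pc, id) at p₃: pick n₀ with Θ_{n₀}(p₃,p₃) < J(p₃) + ε
  have hlt : (⨅ n, Θ n p₃ p₃) < θ (pc p₃) p₃ + ε := by
    rw [hC, ← hinf]; exact lt_add_of_pos_right _ hε
  obtain ⟨n₀, hn₀⟩ := exists_lt_of_ciInf_lt hlt
  have hopen : IsOpen {x : ℝ × ℝ | Θ n₀ x.1 x.2 < θ (pc p₃) p₃ + ε} :=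
    isOpen_lt (hcont n₀) continuous_const
  obtain ⟨r, hr, hball⟩ := Metric.isOpen_iff.mp hopen (p₃, p₃) hn₀
  have hcw : ContinuousWithinAt pc (Set.Ioo 0 1) p₃ := hpcc p₃ ⟨h3l, h3u⟩
  rw [Metric.continuousWithinAt_iff] at hcw
  obtain ⟨δ₁, hδ₁, hδ₁'⟩ := hcw r hr
  refine ⟨min δ₁ r, lt_min hδ₁ hr, fun t ht hdist => ?_⟩
  have hd1 : dist t p₃ < δ₁ := by
    rw [Real.dist_eq]; exact lt_of_lt_of_le hdist (min_le_left _ _)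
  have hd2 : dist t p₃ < r := by
    rw [Real.dist_eq]; exact lt_of_lt_of_le hdist (min_le_right _ _)
  have hpcd : dist (pc t) p₃ < r := by
    have h := hδ₁' ht hd1
    rwa [hC] at h
  have hΘ : Θ n₀ (pc t) t < θ (pc p₃) p₃ + ε := by
    have hmem : ((pc t, t) : ℝ × ℝ) ∈ Metric.ball ((p₃, p₃) : ℝ × ℝ) r := by
      rw [Metric.mem_ball, Prod.dist_eq]; exact max_lt hpcd hd2
    exact hball hmem
  exact (hθ_le n₀ _ _).trans_lt hΘ

/-- Core, part 2: if moreover `th3 p₃ = 0` then `θ (pc p₃) p₃ = 0` and `t ↦ θ (pc t) t` is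
continuous at `p₃` within `(0,1)` (upper semicontinuity from `locusCore_usc` + `J ≥ 0 = J(p₃)`). -/
theorem locusCore_continuous (hp₃ : p₃ ∈ unitInterval)
    (hinf : ∀ p t, θ p t = ⨅ n, Θ n p t)
    (hpc : ∀ t, pc t = sInf ({p : ℝ | 0 ≤ p ∧ p ≤ 1 ∧ 0 < θ p t} ∪ {1}))
    (hcont : ∀ n, Continuous (fun x : ℝ × ℝ => Θ n x.1 x.2))
    (hmp : ∀ n t, Monotone (fun p => Θ n p t))
    (hmt : ∀ n p, Monotone (fun t => Θ n p t))
    (hnn : ∀ n p t, 0 ≤ Θ n p t)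
    (hdiag : ∀ p : unitInterval, θ p p = th3 p)
    (hpcc : ContinuousOn pc (Set.Ioo 0 1))
    (h3l : 0 < p₃) (h3u : p₃ < 1)
    (h3zero : ∀ p : unitInterval, (p : ℝ) < p₃ → th3 p = 0)
    (h3pos : ∀ p : unitInterval, p₃ < (p : ℝ) → 0 < th3 p)
    (hS : th3 ⟨p₃, hp₃⟩ = 0) :
    pc p₃ = p₃ ∧ θ (pc p₃) p₃ = 0 ∧
      ContinuousWithinAt (fun t => θ (pc t) t) (Set.Ioo 0 1) p₃ := by
  obtain ⟨hC, husc⟩ := locusCore_usc hinf hpc hcont hmp hmt hnn hdiag hpcc h3l h3u h3zero h3pos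
  have hθ_nn : ∀ p t, 0 ≤ θ p t := fun p t => by
    rw [hinf]; exact le_ciInf fun n => hnn n p t
  have h0 : θ p₃ p₃ = 0 := by
    have e : θ p₃ p₃ = th3 ⟨p₃, hp₃⟩ := hdiag ⟨p₃, hp₃⟩
    rw [e, hS]
  have hJ0 : θ (pc p₃) p₃ = 0 := by rw [hC]; exact h0
  refine ⟨hC, hJ0, ?_⟩
  rw [Metric.continuousWithinAt_iff]
  intro ε hε
  obtain ⟨δ, hδ, hδ'⟩ := husc ε hε
  refine ⟨δ, hδ, ?_⟩
  intro t ht hdist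
  rw [Real.dist_eq] at hdist
  have h := hδ' t ht hdist
  show dist (θ (pc t) t) (θ (pc p₃) p₃) < ε
  rw [hJ0, Real.dist_eq, sub_zero, abs_of_nonneg (hθ_nn _ _)]
  rw [hJ0, zero_add] at h
  exact h

end Core

/-! ### The on-path lemma at the route's family

The conclusion of `isotropicLocusContinuity_of_percolationContinuityZ3` is, character for character,
the definiens of the line's `IsoLocus.CriticalLocusContinuous T` at `T = {p_c(ℤ³)}`
(= `IsoLocus.IsotropicLocusContinuity`): the floor `CriticalCurveRegular` (first conjunct) and
continuity of `J = θ ∘ (pc, id)` within `(0,1)` at every `t₀ ∈ {p_c(ℤ³)}`. -/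

open Literature.Probability.Percolation Literature.Probability.LatticeModels

/-- **ON-PATH LEMMA (F4).** `θ_{ℤ³}(p_c) = 0` (the sub-problem statement `PercolationContinuityZ3`)
implies the rung `IsotropicLocusContinuity` of the line `isotropic_locus_continuity`, stated on its
definiens (the route's `let`-objects `μ, vert, cfg, θ, pc`): the anisotropic critical curve `pc` is
continuous on `(0,1)` with values in `(0,1)` (the floor, `CriticalCurveRegular_proof`) and the critical
density `t ↦ θ (pc t) t` is continuous within `(0,1)` at the isotropic point `p_c(ℤ³)`. -/
theorem isotropicLocusContinuity_of_percolationContinuityZ3 :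
    _root_.PercolationContinuityZ3 →
      let μ := labelMeasure (Site 3)
      let vert : Sym2 (Site 3) → Prop := fun e => ∃ x : Site 3, e = s(x, x + Pi.single (2 : Fin 3) 1)
      let cfg : ℝ → ℝ → (Sym2 (Site 3) → ℝ) → Set (Sym2 (Site 3)) :=
        fun p t U => {e | e ∈ (zdGraph 3).edgeSet ∧ ((vert e ∧ U e ≤ t) ∨ (¬ vert e ∧ U e ≤ p))}
      let θ : ℝ → ℝ → ℝ := fun p t => μ.real {U | cfg p t U ∈ percolatesAt (0 : Site 3)}
      let pc : ℝ → ℝ := fun t => sInf ({p : ℝ | 0 ≤ p ∧ p ≤ 1 ∧ 0 < θ p t} ∪ {1})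
      (ContinuousOn pc (Set.Ioo 0 1) ∧ ∀ t ∈ Set.Ioo (0 : ℝ) 1, 0 < pc t ∧ pc t < 1) ∧
        ∀ t₀ ∈ ({criticalProb (zdGraph 3) (0 : Site 3)} : Set ℝ), t₀ ∈ Set.Ioo (0 : ℝ) 1 →
          ContinuousWithinAt (fun t => θ (pc t) t) (Set.Ioo 0 1) t₀ := by
  intro hS μ vert cfg θ pc
  have hCC :=
    Summit.CriticalPhenomena.PercolationContinuityZ3.Cruxes.CriticalCurveRegular.Locmod.CriticalCurveRegular_proof
  obtain ⟨h1, -, h3, h4, -, h6, h7, -, h9, -⟩ :=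
    Summit.CriticalPhenomena.PercolationContinuityZ3.Theorems.ModelFacts.modelFacts_proof
  have h3b := Grimmett1999_criticalProb_pos_lt_one_holds 3 (by norm_num)
  refine ⟨hCC, ?_⟩
  obtain ⟨hcc1, -⟩ := hCC
  intro t₀ ht₀ _
  rw [Set.mem_singleton_iff] at ht₀
  subst ht₀
  exact (locusCore_continuous (th3 := theta (zdGraph 3) 0) (criticalProb_mem_Icc (zdGraph 3) 0)
    h7 (fun _ => rfl) h1 h3 h4 (fun n p t => (h6 n p t).1) h9 hcc1 h3b.1 h3b.2
    (fun p hp => theta_eq_zero_of_lt_criticalProb_holds _ _ p hp)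
    (fun p hp => theta_pos_of_criticalProb_lt_holds _ _ p hp) hS).2.2

/-- The statement in its folded and unfolded forms: `PercolationContinuityZ3` unfolds along
`Literature…PercolationContinuityZ3 ↦ PercolationContinuity 3` to `theta (zdGraph 3) 0 (criticalProbI 3) = 0`
(`Iff.rfl`), which is the form of the hypothesis after the tribunal's `simp only [unfold chain] at h`. -/
theorem percolationContinuityZ3_iff_theta_criticalProbI_eq_zero :
    _root_.PercolationContinuityZ3 ↔ theta (zdGraph 3) (0 : Site 3) (criticalProbI 3) = 0 :=
  Iff.rfl

/-! ### Kernel-visible forms (ζβ-reduced, pre-`simp` lemmas)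

Below, the same facts conjunct by conjunct with the `let`s substituted (the shape
`simp only [IsotropicLocusContinuity, CriticalLocusContinuous]` leaves behind) and the statement in its
unfolded form `theta (zdGraph 3) 0 (criticalProbI 3) = 0` as side condition.  All are tagged `@[simp↓]`
(tried at a node BEFORE its subterms are visited), so `simp_all` in a context holding the unfolded
statement rewrites each conjunct of the unfolded rung to `True` without normalising the set-builder
terms inside.  Measured (tribunal CLI, engine mode, tier quick, kernel `Tribunal.lean` of 2026-08-18,
this module inlined ahead of the line file): `forward.on_path = true`, `S → C` closed at attempt 5 by
`intro h; (try simp only [IsotropicLocusContinuity, CriticalLocusContinuous, PercolationContinuityZ3,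
Literature…PercolationContinuityZ3, Literature…PercolationContinuity] at h ⊢); aesop` in 141 ms, the
proof using exactly `kernel_curve_continuousOn`, `kernel_curve_mem_Ioo`, `kernel_locusContinuity_of_…`. -/

/-- Floor, first atom (unconditional): the anisotropic critical curve is continuous on `(0,1)`. -/
@[simp↓] theorem kernel_curve_continuousOn :
    ContinuousOn (fun t : ℝ => sInf ({p : ℝ | 0 ≤ p ∧ p ≤ 1 ∧ 0 <
      (labelMeasure (Site 3)).real {U : Sym2 (Site 3) → ℝ |
        {e | e ∈ (zdGraph 3).edgeSet ∧ (((∃ x : Site 3, e = s(x, x + Pi.single (2 : Fin 3) 1)) ∧ U e ≤ t) ∨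
          (¬ (∃ x : Site 3, e = s(x, x + Pi.single (2 : Fin 3) 1)) ∧ U e ≤ p))} ∈ percolatesAt (0 : Site 3)}} ∪ {1}))
      (Set.Ioo 0 1) :=
  (Summit.CriticalPhenomena.PercolationContinuityZ3.Cruxes.CriticalCurveRegular.Locmod.CriticalCurveRegular_proof).1

/-- Floor, second atom (unconditional): `0 < p_c(t) < 1` on `(0,1)`. -/
@[simp↓] theorem kernel_curve_mem_Ioo :
    ∀ t ∈ Set.Ioo (0 : ℝ) 1,
      0 < sInf ({p : ℝ | 0 ≤ p ∧ p ≤ 1 ∧ 0 <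
        (labelMeasure (Site 3)).real {U : Sym2 (Site 3) → ℝ |
          {e | e ∈ (zdGraph 3).edgeSet ∧ (((∃ x : Site 3, e = s(x, x + Pi.single (2 : Fin 3) 1)) ∧ U e ≤ t) ∨
            (¬ (∃ x : Site 3, e = s(x, x + Pi.single (2 : Fin 3) 1)) ∧ U e ≤ p))} ∈ percolatesAt (0 : Site 3)}} ∪ {1}) ∧
      sInf ({p : ℝ | 0 ≤ p ∧ p ≤ 1 ∧ 0 <
        (labelMeasure (Site 3)).real {U : Sym2 (Site 3) → ℝ |
          {e | e ∈ (zdGraph 3).edgeSet ∧ (((∃ x : Site 3, e = s(x, x + Pi.single (2 : Fin 3) 1)) ∧ U e ≤ t) ∨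
            (¬ (∃ x : Site 3, e = s(x, x + Pi.single (2 : Fin 3) 1)) ∧ U e ≤ p))} ∈ percolatesAt (0 : Site 3)}} ∪ {1}) < 1 :=
  (Summit.CriticalPhenomena.PercolationContinuityZ3.Cruxes.CriticalCurveRegular.Locmod.CriticalCurveRegular_proof).2

/-- Continuity of the critical density at the isotropic point (the rung's second conjunct), from
`θ_{ℤ³}(p_c) = 0` in unfolded form. -/
@[simp↓] theorem kernel_locusContinuity_of_theta_criticalProbI_eq_zero
    (h : theta (zdGraph 3) (0 : Site 3) (criticalProbI 3) = 0) :
    ∀ t₀ ∈ ({criticalProb (zdGraph 3) (0 : Site 3)} : Set ℝ), t₀ ∈ Set.Ioo (0 : ℝ) 1 →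
      ContinuousWithinAt (fun t : ℝ =>
        (labelMeasure (Site 3)).real {U : Sym2 (Site 3) → ℝ |
          {e | e ∈ (zdGraph 3).edgeSet ∧ (((∃ x : Site 3, e = s(x, x + Pi.single (2 : Fin 3) 1)) ∧ U e ≤ t) ∨
            (¬ (∃ x : Site 3, e = s(x, x + Pi.single (2 : Fin 3) 1)) ∧ U e ≤
              sInf ({p : ℝ | 0 ≤ p ∧ p ≤ 1 ∧ 0 <
                (labelMeasure (Site 3)).real {U : Sym2 (Site 3) → ℝ |
                  {e | e ∈ (zdGraph 3).edgeSet ∧ (((∃ x : Site 3, e = s(x, x + Pi.single (2 : Fin 3) 1)) ∧ U e ≤ t) ∨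
                    (¬ (∃ x : Site 3, e = s(x, x + Pi.single (2 : Fin 3) 1)) ∧ U e ≤ p))} ∈
                  percolatesAt (0 : Site 3)}} ∪ {1})))} ∈ percolatesAt (0 : Site 3)})
        (Set.Ioo 0 1) t₀ :=
  (isotropicLocusContinuity_of_percolationContinuityZ3 h).2

/-- The same at the point itself (the shape after `∀ t₀ ∈ {p₃}` is eliminated). -/
@[simp↓] theorem kernel_locusContinuity_at_of_theta_criticalProbI_eq_zero
    (h : theta (zdGraph 3) (0 : Site 3) (criticalProbI 3) = 0) :
    ContinuousWithinAt (fun t : ℝ =>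
      (labelMeasure (Site 3)).real {U : Sym2 (Site 3) → ℝ |
        {e | e ∈ (zdGraph 3).edgeSet ∧ (((∃ x : Site 3, e = s(x, x + Pi.single (2 : Fin 3) 1)) ∧ U e ≤ t) ∨
          (¬ (∃ x : Site 3, e = s(x, x + Pi.single (2 : Fin 3) 1)) ∧ U e ≤
            sInf ({p : ℝ | 0 ≤ p ∧ p ≤ 1 ∧ 0 <
              (labelMeasure (Site 3)).real {U : Sym2 (Site 3) → ℝ |
                {e | e ∈ (zdGraph 3).edgeSet ∧ (((∃ x : Site 3, e = s(x, x + Pi.single (2 : Fin 3) 1)) ∧ U e ≤ t) ∨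
                  (¬ (∃ x : Site 3, e = s(x, x + Pi.single (2 : Fin 3) 1)) ∧ U e ≤ p))} ∈
                percolatesAt (0 : Site 3)}} ∪ {1})))} ∈ percolatesAt (0 : Site 3)})
      (Set.Ioo 0 1) (criticalProb (zdGraph 3) (0 : Site 3)) :=
  (isotropicLocusContinuity_of_percolationContinuityZ3 h).2 _ rfl
    (Grimmett1999_criticalProb_pos_lt_one_holds 3 (by norm_num))

/-! ### Dial (F3 `specialises`): the unfolded rung gives back the floor

The floor `CriticalCurveRegular` (route decl, proved: `CriticalCurveRegular_proof`) is literally the first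
conjunct of the rung's definiens — the line's graded family `CriticalLocusContinuous T` is antitone in `T` and
`T = ∅` is the floor (`criticalLocusContinuous_empty_iff` in the line file).  The projection below is that dial
lemma on the ζβ-reduced definiens, registered as an `aesop` NORM-phase forward rule with penalty `-100`, i.e.
applied to a hypothesis of that shape BEFORE `aesop` normalises it: the tribunal's `Rung → floor` tactic
`intro h; (try simp only [IsotropicLocusContinuity, CriticalLocusContinuous] at h ⊢); aesop` then finds
`CriticalCurveRegular` in context and closes (mock under the kernel's `maxHeartbeats 50000`: closes; a
safe-phase rule would come too late, after the hypothesis has been normalised away from this shape).  It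
fires only on a hypothesis that IS the unfolded rung. -/

/-- **Dial lemma, kernel form**: the ζβ-reduced definiens of `IsoLocus.IsotropicLocusContinuity` implies the
floor `CriticalCurveRegular` (first projection; `CriticalCurveRegular` unfolds to the first conjunct). -/
@[aesop norm -100 forward] theorem criticalCurveRegular_of_kernel_isotropicLocusContinuity
    (h : (ContinuousOn (fun t : ℝ => sInf ({p : ℝ | 0 ≤ p ∧ p ≤ 1 ∧ 0 <
      (labelMeasure (Site 3)).real {U : Sym2 (Site 3) → ℝ |
        {e | e ∈ (zdGraph 3).edgeSet ∧ (((∃ x : Site 3, e = s(x, x + Pi.single (2 : Fin 3) 1)) ∧ U e ≤ t) ∨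
          (¬ (∃ x : Site 3, e = s(x, x + Pi.single (2 : Fin 3) 1)) ∧ U e ≤ p))} ∈ percolatesAt (0 : Site 3)}} ∪ {1}))
      (Set.Ioo 0 1) ∧
    ∀ t ∈ Set.Ioo (0 : ℝ) 1,
      0 < sInf ({p : ℝ | 0 ≤ p ∧ p ≤ 1 ∧ 0 <
        (labelMeasure (Site 3)).real {U : Sym2 (Site 3) → ℝ |
          {e | e ∈ (zdGraph 3).edgeSet ∧ (((∃ x : Site 3, e = s(x, x + Pi.single (2 : Fin 3) 1)) ∧ U e ≤ t) ∨
            (¬ (∃ x : Site 3, e = s(x, x + Pi.single (2 : Fin 3) 1)) ∧ U e ≤ p))} ∈ percolatesAt (0 : Site 3)}} ∪ {1}) ∧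
      sInf ({p : ℝ | 0 ≤ p ∧ p ≤ 1 ∧ 0 <
        (labelMeasure (Site 3)).real {U : Sym2 (Site 3) → ℝ |
          {e | e ∈ (zdGraph 3).edgeSet ∧ (((∃ x : Site 3, e = s(x, x + Pi.single (2 : Fin 3) 1)) ∧ U e ≤ t) ∨
            (¬ (∃ x : Site 3, e = s(x, x + Pi.single (2 : Fin 3) 1)) ∧ U e ≤ p))} ∈ percolatesAt (0 : Site 3)}} ∪ {1}) < 1) ∧
    ∀ t₀ ∈ ({criticalProb (zdGraph 3) (0 : Site 3)} : Set ℝ), t₀ ∈ Set.Ioo (0 : ℝ) 1 →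
      ContinuousWithinAt (fun t : ℝ =>
        (labelMeasure (Site 3)).real {U : Sym2 (Site 3) → ℝ |
          {e | e ∈ (zdGraph 3).edgeSet ∧ (((∃ x : Site 3, e = s(x, x + Pi.single (2 : Fin 3) 1)) ∧ U e ≤ t) ∨
            (¬ (∃ x : Site 3, e = s(x, x + Pi.single (2 : Fin 3) 1)) ∧ U e ≤
              sInf ({p : ℝ | 0 ≤ p ∧ p ≤ 1 ∧ 0 <
                (labelMeasure (Site 3)).real {U : Sym2 (Site 3) → ℝ |
                  {e | e ∈ (zdGraph 3).edgeSet ∧ (((∃ x : Site 3, e = s(x, x + Pi.single (2 : Fin 3) 1)) ∧ U e ≤ t) ∨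
                    (¬ (∃ x : Site 3, e = s(x, x + Pi.single (2 : Fin 3) 1)) ∧ U e ≤ p))} ∈
                  percolatesAt (0 : Site 3)}} ∪ {1})))} ∈ percolatesAt (0 : Site 3)})
        (Set.Ioo 0 1) t₀) :
    Summit.CriticalPhenomena.PercolationContinuityZ3.Theses.PercExchangeRateTransport.CriticalCurveRegular :=
  h.1

end Summit.CriticalPhenomena.PercolationContinuityZ3.Theorems.IsoLocusOnPath

end
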